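import Literature.Analysis.Fourier.HilbertTransformLineSkewAdjoint
import Literature.Analysis.Fourier.HilbertTransformLineSplit
import HarnessLib

/-!
# SHEET-ℝ, EVEN half of Z3-SR-SPEC: the MASS IDENTITY `m ∘ DG⁺(Ω) = ½·m` — the massive direction carries the exact
# eigenvalue `σ = −½` of `−DG⁺(Ω)`, and every classical eigenfunction with `σ ≠ −½` is massless (the calculus core of
# DESIGN (D1) / PREREG P4 item PO-1)

HONEST FRAMING (cell ns-blowup GROUP B / zone Z3, case Z3-SR-SPEC EVEN half (SPEC-EVEN-R1), PREREG
`HOME/profile/cert/impl1/sheetR/spec/even/PREREG-Z3-SR-SPEC-EVEN.md` v1.1 84357d3d94388851 §P4, DESIGN `DESIGN-Z3-SR-SPEC-EVEN.md` §1 (D1) /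
§2 (PO-1); profile-lead WORD (iq)(2) «P4 paper items as kernel files where they are calculus, 0 kit»; 1-D MODEL — the linearisation
`DG⁺(Ω)[δ] = δ + ½ξδ′ + a·(𝒰δ·Ω′ + 𝒰Ω·δ′) − Hδ·Ω − HΩ·δ − νδ″` of the viscous gCLM / OSW sheet-ℝ profile map; not Euler, not NS;
«violates: none — MODEL»). Nothing here asserts that a profile or an eigenfunction exists; no number of any certificate moves.

DESIGN (D1) says: «mass `m(δ) = ∫δ` is bounded on `L²_w` and `m ∘ DG⁺ = ½·m` (integration by parts + antisymmetry of `H`; both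
gauges), so the massive direction carries the exact eigenvalue `σ = −½` of `−DG⁺` and every even eigenfunction with `σ ≠ −½` is massless:
the census on `{Re σ ≥ −0.03}` is the same on `E⁺` and on `E⁺₀`»; PO-1 uses the same computation (`∫(DG⁺ + σ)δ = (½ + σ)·m(δ)`).
THIS FILE proves that computation as pure calculus, for ANY velocity gauge: the perturbation velocities enter only through
`(𝒰δ)′ = Hδ`, `(𝒰Ω)′ = HΩ` (so both the translation-covariant `∫_{−∞}^ξ H·` and the pinned `∫₀^ξ H·` spellings are covered), and
parity is NOT used (on odd `δ` both sides vanish trivially).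
* `integral_hilbert_pairing_eq_zero`: `∫ (Hδ·Ω + HΩ·δ) = 0` for `δ, Ω ∈ L¹ ∩ L²` with integrable symmetric p.v. integrands — the tree's
  skew-adjointness `Literature.Analysis.Fourier.integral_hilbertTransform_mul_eq_neg` [Grafakos2014 §5.1.1].
* `integral_linearisation_eq_half_integral` (**the mass identity**): under `L¹` hypotheses on `ξδ, ξδ′, δ′, δ″`, the velocity products and
  the Hilbert pairings, `∫ DG⁺(Ω)[δ] = ½ ∫ δ` — from `∫(ξδ)′ = 0`, `∫(𝒰δ·Ω + 𝒰Ω·δ)′ = 0`, `∫δ″ = 0`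
  (`MeasureTheory.integral_eq_zero_of_hasDerivAt_of_integrable`) and the pairing lemma.
* `mass_mul_eq_zero_of_eigen` / `mass_eq_zero_of_eigen` / `eq_neg_half_of_mass_ne_zero`: a classical solution of `−DG⁺(Ω)[δ] = σ·δ`
  in that class has `(σ + ½)·∫δ = 0`; hence `∫δ = 0` unless `σ = −½`, and a massive eigenfunction forces `σ = −½`.
* `mass_eq_zero_of_eigen_pair`: the same for a COMPLEX eigenvalue `σ = s + it` written on the real pair `(δ₁, δ₂)`
  (`−DG⁺δ₁ = sδ₁ − tδ₂`, `−DG⁺δ₂ = tδ₁ + sδ₂`): `(s, t) ≠ (−½, 0) ⇒ ∫δ₁ = ∫δ₂ = 0`.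
* `integral_linearisation_eq_half_integral_of_contDiff`: the p.v. hypotheses discharged for `δ, Ω ∈ C¹ ∩ L¹ ∩ L²`
  (`integrableOn_symmIntegrand_of_contDiff`).
What stays PAPER of PO-1 after this file: the functional-analytic half (an `E⁺₀`-weak eigenfunction is a distributional, hence classical,
eigenfunction with the decay used here) — it needs the even-class weak formulation, which the tree does not have.
[folklore] 1-D calculus; MODEL-support, no NS content.
-/

noncomputable section

namespace Summit.NavierStokesRegularity.OSWSelfSimilar
namespace SheetRLinearisedMass

open _root_.MeasureTheory _root_.Set _root_.Filter Literature.Analysis.Fourier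
open scoped Real Topology

variable {a ν : ℝ} {Ω δ UΩ Uδ : ℝ → ℝ}

/-! ### §1 The Hilbert pairing -/

/-- **The symmetric Hilbert pairing vanishes**: `∫ (Hδ·Ω + HΩ·δ) = 0` for real `δ, Ω ∈ L¹ ∩ L²` whose symmetric p.v. integrands are
integrable on `(0,∞)` at a.e. point — one line from the tree's skew-adjointness `∫(Hδ)Ω = −∫δ(HΩ)`
(`Literature.Analysis.Fourier.integral_hilbertTransform_mul_eq_neg`, Grafakos §5.1.1). [folklore] -/
theorem integral_hilbert_pairing_eq_zero (hδi : Integrable δ) (hδ2 : MemLp δ 2) (hΩi : Integrable Ω) (hΩ2 : MemLp Ω 2)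
    (hintδ : ∀ᵐ x : ℝ, IntegrableOn (fun t => (δ (x - t) - δ (x + t)) / t) (Ioi 0))
    (hintΩ : ∀ᵐ x : ℝ, IntegrableOn (fun t => (Ω (x - t) - Ω (x + t)) / t) (Ioi 0)) :
    ∫ X, (hilbertTransform δ X * Ω X + hilbertTransform Ω X * δ X) = 0 := by
  have hI1 : Integrable fun X => hilbertTransform δ X * Ω X :=
    (memLp_two_hilbertTransform hδi hδ2 hintδ).integrable_mul hΩ2
  have hI2 : Integrable fun X => hilbertTransform Ω X * δ X :=
    (memLp_two_hilbertTransform hΩi hΩ2 hintΩ).integrable_mul hδ2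
  rw [integral_add hI1 hI2, integral_hilbertTransform_mul_eq_neg hδi hδ2 hΩi hΩ2 hintδ hintΩ]
  have e : ∫ X, hilbertTransform Ω X * δ X = ∫ X, δ X * hilbertTransform Ω X :=
    integral_congr_ae (ae_of_all _ fun X => mul_comm _ _)
  rw [e]; ring

/-! ### §2 The mass identity -/

/-- **THE MASS IDENTITY `∫ DG⁺(Ω)[δ] = ½ ∫ δ`.** Let `δ ∈ C²`, `Ω ∈ C¹`, and let `Uδ`, `UΩ` be ANY perturbation / base velocities with
`(Uδ)′ = Hδ`, `(UΩ)′ = HΩ` (covariant or pinned gauge alike). Assume `δ, Ω ∈ L¹ ∩ L²` with integrable symmetric p.v. integrands,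
`ξδ, ξδ′, δ′, δ″ ∈ L¹`, `Uδ·Ω + UΩ·δ ∈ L¹` and `Uδ·Ω′, UΩ·δ′ ∈ L¹`. Then
`∫ [δ + ½ξδ′ + a·(Uδ·Ω′ + UΩ·δ′) − Hδ·Ω − HΩ·δ − ν·δ″] = ½ ∫ δ`:
the transport term gives `∫(δ + ½ξδ′) = ½∫δ` (`∫(ξδ)′ = 0`), the velocity term gives `a∫(Uδ·Ω′ + UΩ·δ′) = −a∫(Hδ·Ω + HΩ·δ)`
(`∫(Uδ·Ω + UΩ·δ)′ = 0`), both Hilbert pairings vanish by skew-adjointness, and `∫δ″ = 0`. DESIGN (D1) «`m ∘ DG⁺ = ½·m`».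
MODEL calculus; not NS. [folklore] -/
theorem integral_linearisation_eq_half_integral (hδ : ContDiff ℝ 2 δ) (hΩ : ContDiff ℝ 1 Ω)
    (hUδ : ∀ X, HasDerivAt Uδ (hilbertTransform δ X) X) (hUΩ : ∀ X, HasDerivAt UΩ (hilbertTransform Ω X) X)
    (hδi : Integrable δ) (hδ2 : MemLp δ 2) (hΩi : Integrable Ω) (hΩ2 : MemLp Ω 2)
    (hintδ : ∀ᵐ x : ℝ, IntegrableOn (fun t => (δ (x - t) - δ (x + t)) / t) (Ioi 0))
    (hintΩ : ∀ᵐ x : ℝ, IntegrableOn (fun t => (Ω (x - t) - Ω (x + t)) / t) (Ioi 0))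
    (hxδ : Integrable fun X => X * δ X) (hxδ' : Integrable fun X => X * deriv δ X)
    (hδ'i : Integrable (deriv δ)) (hδ''i : Integrable (deriv (deriv δ)))
    (hF : Integrable fun X => Uδ X * Ω X + UΩ X * δ X)
    (hUδΩ' : Integrable fun X => Uδ X * deriv Ω X) (hUΩδ' : Integrable fun X => UΩ X * deriv δ X) :
    ∫ X, (δ X + 1 / 2 * X * deriv δ X + a * (Uδ X * deriv Ω X + UΩ X * deriv δ X)
        - hilbertTransform δ X * Ω X - hilbertTransform Ω X * δ X - ν * deriv (deriv δ) X) = 1 / 2 * ∫ X, δ X := by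
  -- derivatives
  have hδ1 : ContDiff ℝ 1 δ := hδ.of_le (by norm_num)
  have hd1 : ∀ X, HasDerivAt δ (deriv δ X) X := fun X => ((hδ1.differentiable one_ne_zero) X).hasDerivAt
  have hδ'1 : ContDiff ℝ 1 (deriv δ) := (contDiff_succ_iff_deriv.1 (hδ : ContDiff ℝ (1 + 1) δ)).2.2
  have hd2 : ∀ X, HasDerivAt (deriv δ) (deriv (deriv δ) X) X :=
    fun X => ((hδ'1.differentiable one_ne_zero) X).hasDerivAt
  have hdΩ : ∀ X, HasDerivAt Ω (deriv Ω X) X := fun X => ((hΩ.differentiable one_ne_zero) X).hasDerivAt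
  -- the two Hilbert pairings are integrable and their sum integrates to zero
  have hI1 : Integrable fun X => hilbertTransform δ X * Ω X :=
    (memLp_two_hilbertTransform hδi hδ2 hintδ).integrable_mul hΩ2
  have hI2 : Integrable fun X => hilbertTransform Ω X * δ X :=
    (memLp_two_hilbertTransform hΩi hΩ2 hintΩ).integrable_mul hδ2
  have hS : Integrable fun X => hilbertTransform δ X * Ω X + hilbertTransform Ω X * δ X := hI1.fun_add hI2
  have e3 := integral_hilbert_pairing_eq_zero hδi hδ2 hΩi hΩ2 hintδ hintΩ
  -- transport: `∫ (δ + ξδ′) = ∫ (ξδ)′ = 0`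
  have hT : ∀ X, HasDerivAt (fun Y => Y * δ Y) (δ X + X * deriv δ X) X := fun X => by
    have h := (hasDerivAt_id' X).mul (hd1 X)
    have e : ((fun Y : ℝ => Y) * δ : ℝ → ℝ) = fun Y => Y * δ Y := funext fun Y => rfl
    rw [e] at h
    exact h.congr_deriv (by simp only [one_mul])
  have e1 : ∫ X, (δ X + X * deriv δ X) = 0 :=
    integral_eq_zero_of_hasDerivAt_of_integrable hT (hδi.fun_add hxδ') hxδ
  -- velocities: `∫ (Uδ·Ω + UΩ·δ)′ = 0`
  have hG : ∀ X, HasDerivAt (fun Y => Uδ Y * Ω Y + UΩ Y * δ Y)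
      (hilbertTransform δ X * Ω X + Uδ X * deriv Ω X + (hilbertTransform Ω X * δ X + UΩ X * deriv δ X)) X := fun X => by
    have h := ((hUδ X).mul (hdΩ X)).add ((hUΩ X).mul (hd1 X))
    have e : (Uδ * Ω + UΩ * δ : ℝ → ℝ) = fun Y => Uδ Y * Ω Y + UΩ Y * δ Y := funext fun Y => rfl
    rw [e] at h
    exact h
  have e2 : ∫ X, (hilbertTransform δ X * Ω X + Uδ X * deriv Ω X + (hilbertTransform Ω X * δ X + UΩ X * deriv δ X)) = 0 :=
    integral_eq_zero_of_hasDerivAt_of_integrable hG ((hI1.fun_add hUδΩ').fun_add (hI2.fun_add hUΩδ')) hF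
  -- diffusion: `∫ δ″ = 0`
  have e4 : ∫ X, deriv (deriv δ) X = 0 := integral_eq_zero_of_hasDerivAt_of_integrable hd2 hδ''i hδ'i
  -- bookkeeping
  have hpt : (fun X => δ X + 1 / 2 * X * deriv δ X + a * (Uδ X * deriv Ω X + UΩ X * deriv δ X)
        - hilbertTransform δ X * Ω X - hilbertTransform Ω X * δ X - ν * deriv (deriv δ) X)
      = fun X => (1 / 2 * δ X + 1 / 2 * (δ X + X * deriv δ X)
          + a * (hilbertTransform δ X * Ω X + Uδ X * deriv Ω X + (hilbertTransform Ω X * δ X + UΩ X * deriv δ X)))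
        - ((1 + a) * (hilbertTransform δ X * Ω X + hilbertTransform Ω X * δ X) + ν * deriv (deriv δ) X) := by
    funext X; ring
  have h1 : Integrable fun X => 1 / 2 * δ X := hδi.const_mul _
  have h2 : Integrable fun X => 1 / 2 * (δ X + X * deriv δ X) := (hδi.fun_add hxδ').const_mul _
  have h3 : Integrable fun X =>
      a * (hilbertTransform δ X * Ω X + Uδ X * deriv Ω X + (hilbertTransform Ω X * δ X + UΩ X * deriv δ X)) :=
    ((hI1.fun_add hUδΩ').fun_add (hI2.fun_add hUΩδ')).const_mul _
  have h4 : Integrable fun X => (1 + a) * (hilbertTransform δ X * Ω X + hilbertTransform Ω X * δ X) := hS.const_mul _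
  have h5 : Integrable fun X => ν * deriv (deriv δ) X := hδ''i.const_mul _
  rw [hpt, integral_sub ((h1.fun_add h2).fun_add h3) (h4.fun_add h5), integral_add (h1.fun_add h2) h3,
    integral_add h1 h2, integral_add h4 h5, integral_const_mul, integral_const_mul, integral_const_mul,
    integral_const_mul, integral_const_mul, e1, e2, e3, e4]
  ring

/-! ### §3 Consequences for classical eigenfunctions -/

/-- **`(σ + ½)·m(δ) = 0` for a classical eigenfunction.** Under the hypotheses of `integral_linearisation_eq_half_integral`, if
`−DG⁺(Ω)[δ] = σ·δ` pointwise then `(σ + ½)·∫δ = 0`. MODEL calculus; not NS. [folklore] -/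
theorem mass_mul_eq_zero_of_eigen {σ : ℝ} (hδ : ContDiff ℝ 2 δ) (hΩ : ContDiff ℝ 1 Ω)
    (hUδ : ∀ X, HasDerivAt Uδ (hilbertTransform δ X) X) (hUΩ : ∀ X, HasDerivAt UΩ (hilbertTransform Ω X) X)
    (hδi : Integrable δ) (hδ2 : MemLp δ 2) (hΩi : Integrable Ω) (hΩ2 : MemLp Ω 2)
    (hintδ : ∀ᵐ x : ℝ, IntegrableOn (fun t => (δ (x - t) - δ (x + t)) / t) (Ioi 0))
    (hintΩ : ∀ᵐ x : ℝ, IntegrableOn (fun t => (Ω (x - t) - Ω (x + t)) / t) (Ioi 0))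
    (hxδ : Integrable fun X => X * δ X) (hxδ' : Integrable fun X => X * deriv δ X)
    (hδ'i : Integrable (deriv δ)) (hδ''i : Integrable (deriv (deriv δ)))
    (hF : Integrable fun X => Uδ X * Ω X + UΩ X * δ X)
    (hUδΩ' : Integrable fun X => Uδ X * deriv Ω X) (hUΩδ' : Integrable fun X => UΩ X * deriv δ X)
    (heig : ∀ X, -(δ X + 1 / 2 * X * deriv δ X + a * (Uδ X * deriv Ω X + UΩ X * deriv δ X)
        - hilbertTransform δ X * Ω X - hilbertTransform Ω X * δ X - ν * deriv (deriv δ) X) = σ * δ X) :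
    (σ + 1 / 2) * ∫ X, δ X = 0 := by
  have h := integral_linearisation_eq_half_integral (a := a) (ν := ν) hδ hΩ hUδ hUΩ hδi hδ2 hΩi hΩ2 hintδ hintΩ hxδ hxδ'
    hδ'i hδ''i hF hUδΩ' hUΩδ'
  have e : (fun X => δ X + 1 / 2 * X * deriv δ X + a * (Uδ X * deriv Ω X + UΩ X * deriv δ X)
        - hilbertTransform δ X * Ω X - hilbertTransform Ω X * δ X - ν * deriv (deriv δ) X) = fun X => -σ * δ X := by
    funext X; linear_combination -(heig X)
  rw [e, integral_const_mul] at h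
  linear_combination -h

/-- **Every classical eigenfunction with `σ ≠ −½` is massless**: `∫δ = 0`. DESIGN (D1); the census of `−DG⁺` on
`{Re σ ≥ −0.03}` is the same with or without the zero-mass constraint. MODEL calculus; not NS. [folklore] -/
theorem mass_eq_zero_of_eigen {σ : ℝ} (hσ : σ ≠ -(1 / 2)) (hδ : ContDiff ℝ 2 δ) (hΩ : ContDiff ℝ 1 Ω)
    (hUδ : ∀ X, HasDerivAt Uδ (hilbertTransform δ X) X) (hUΩ : ∀ X, HasDerivAt UΩ (hilbertTransform Ω X) X)
    (hδi : Integrable δ) (hδ2 : MemLp δ 2) (hΩi : Integrable Ω) (hΩ2 : MemLp Ω 2)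
    (hintδ : ∀ᵐ x : ℝ, IntegrableOn (fun t => (δ (x - t) - δ (x + t)) / t) (Ioi 0))
    (hintΩ : ∀ᵐ x : ℝ, IntegrableOn (fun t => (Ω (x - t) - Ω (x + t)) / t) (Ioi 0))
    (hxδ : Integrable fun X => X * δ X) (hxδ' : Integrable fun X => X * deriv δ X)
    (hδ'i : Integrable (deriv δ)) (hδ''i : Integrable (deriv (deriv δ)))
    (hF : Integrable fun X => Uδ X * Ω X + UΩ X * δ X)
    (hUδΩ' : Integrable fun X => Uδ X * deriv Ω X) (hUΩδ' : Integrable fun X => UΩ X * deriv δ X)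
    (heig : ∀ X, -(δ X + 1 / 2 * X * deriv δ X + a * (Uδ X * deriv Ω X + UΩ X * deriv δ X)
        - hilbertTransform δ X * Ω X - hilbertTransform Ω X * δ X - ν * deriv (deriv δ) X) = σ * δ X) :
    ∫ X, δ X = 0 := by
  have h := mass_mul_eq_zero_of_eigen hδ hΩ hUδ hUΩ hδi hδ2 hΩi hΩ2 hintδ hintΩ hxδ hxδ' hδ'i hδ''i hF hUδΩ' hUΩδ' heig
  have hne : σ + 1 / 2 ≠ 0 := fun h0 => hσ (by linarith)
  exact (mul_eq_zero.1 h).resolve_left hne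

/-- **A massive classical eigenfunction has `σ = −½`** (the eigenvalue of the massive direction; DESIGN (D1)). MODEL calculus; not NS.
[folklore] -/
theorem eq_neg_half_of_mass_ne_zero {σ : ℝ} (hm : ∫ X, δ X ≠ 0) (hδ : ContDiff ℝ 2 δ) (hΩ : ContDiff ℝ 1 Ω)
    (hUδ : ∀ X, HasDerivAt Uδ (hilbertTransform δ X) X) (hUΩ : ∀ X, HasDerivAt UΩ (hilbertTransform Ω X) X)
    (hδi : Integrable δ) (hδ2 : MemLp δ 2) (hΩi : Integrable Ω) (hΩ2 : MemLp Ω 2)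
    (hintδ : ∀ᵐ x : ℝ, IntegrableOn (fun t => (δ (x - t) - δ (x + t)) / t) (Ioi 0))
    (hintΩ : ∀ᵐ x : ℝ, IntegrableOn (fun t => (Ω (x - t) - Ω (x + t)) / t) (Ioi 0))
    (hxδ : Integrable fun X => X * δ X) (hxδ' : Integrable fun X => X * deriv δ X)
    (hδ'i : Integrable (deriv δ)) (hδ''i : Integrable (deriv (deriv δ)))
    (hF : Integrable fun X => Uδ X * Ω X + UΩ X * δ X)
    (hUδΩ' : Integrable fun X => Uδ X * deriv Ω X) (hUΩδ' : Integrable fun X => UΩ X * deriv δ X)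
    (heig : ∀ X, -(δ X + 1 / 2 * X * deriv δ X + a * (Uδ X * deriv Ω X + UΩ X * deriv δ X)
        - hilbertTransform δ X * Ω X - hilbertTransform Ω X * δ X - ν * deriv (deriv δ) X) = σ * δ X) :
    σ = -(1 / 2) := by
  by_contra hσ
  exact hm (mass_eq_zero_of_eigen hσ hδ hΩ hUδ hUΩ hδi hδ2 hΩi hΩ2 hintδ hintΩ hxδ hxδ' hδ'i hδ''i hF hUδΩ' hUΩδ' heig)

/-- **Complex eigenvalues, on the real pair.** Let `δ₁, δ₂` (with velocities `U₁, U₂`) both satisfy the hypotheses of the mass identity and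
solve the coupled system `−DG⁺(Ω)[δ₁] = s·δ₁ − t·δ₂`, `−DG⁺(Ω)[δ₂] = t·δ₁ + s·δ₂` (the real form of `−DG⁺δ = σδ`, `δ = δ₁ + iδ₂`,
`σ = s + it`). If `(s, t) ≠ (−½, 0)` then `∫δ₁ = ∫δ₂ = 0`. MODEL calculus; not NS. [folklore] -/
theorem mass_eq_zero_of_eigen_pair {s t : ℝ} {δ₁ δ₂ U₁ U₂ : ℝ → ℝ} (hst : ¬(s = -(1 / 2) ∧ t = 0)) (hΩ : ContDiff ℝ 1 Ω)
    (hUΩ : ∀ X, HasDerivAt UΩ (hilbertTransform Ω X) X) (hΩi : Integrable Ω) (hΩ2 : MemLp Ω 2)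
    (hintΩ : ∀ᵐ x : ℝ, IntegrableOn (fun t => (Ω (x - t) - Ω (x + t)) / t) (Ioi 0))
    (hδ₁ : ContDiff ℝ 2 δ₁) (hU₁ : ∀ X, HasDerivAt U₁ (hilbertTransform δ₁ X) X) (hδ₁i : Integrable δ₁) (hδ₁2 : MemLp δ₁ 2)
    (hintδ₁ : ∀ᵐ x : ℝ, IntegrableOn (fun t => (δ₁ (x - t) - δ₁ (x + t)) / t) (Ioi 0))
    (hxδ₁ : Integrable fun X => X * δ₁ X) (hxδ₁' : Integrable fun X => X * deriv δ₁ X)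
    (hδ₁'i : Integrable (deriv δ₁)) (hδ₁''i : Integrable (deriv (deriv δ₁)))
    (hF₁ : Integrable fun X => U₁ X * Ω X + UΩ X * δ₁ X)
    (hU₁Ω' : Integrable fun X => U₁ X * deriv Ω X) (hUΩδ₁' : Integrable fun X => UΩ X * deriv δ₁ X)
    (hδ₂ : ContDiff ℝ 2 δ₂) (hU₂ : ∀ X, HasDerivAt U₂ (hilbertTransform δ₂ X) X) (hδ₂i : Integrable δ₂) (hδ₂2 : MemLp δ₂ 2)
    (hintδ₂ : ∀ᵐ x : ℝ, IntegrableOn (fun t => (δ₂ (x - t) - δ₂ (x + t)) / t) (Ioi 0))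
    (hxδ₂ : Integrable fun X => X * δ₂ X) (hxδ₂' : Integrable fun X => X * deriv δ₂ X)
    (hδ₂'i : Integrable (deriv δ₂)) (hδ₂''i : Integrable (deriv (deriv δ₂)))
    (hF₂ : Integrable fun X => U₂ X * Ω X + UΩ X * δ₂ X)
    (hU₂Ω' : Integrable fun X => U₂ X * deriv Ω X) (hUΩδ₂' : Integrable fun X => UΩ X * deriv δ₂ X)
    (heig₁ : ∀ X, -(δ₁ X + 1 / 2 * X * deriv δ₁ X + a * (U₁ X * deriv Ω X + UΩ X * deriv δ₁ X)
        - hilbertTransform δ₁ X * Ω X - hilbertTransform Ω X * δ₁ X - ν * deriv (deriv δ₁) X) = s * δ₁ X - t * δ₂ X)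
    (heig₂ : ∀ X, -(δ₂ X + 1 / 2 * X * deriv δ₂ X + a * (U₂ X * deriv Ω X + UΩ X * deriv δ₂ X)
        - hilbertTransform δ₂ X * Ω X - hilbertTransform Ω X * δ₂ X - ν * deriv (deriv δ₂) X) = t * δ₁ X + s * δ₂ X) :
    (∫ X, δ₁ X) = 0 ∧ ∫ X, δ₂ X = 0 := by
  have h₁ := integral_linearisation_eq_half_integral (a := a) (ν := ν) hδ₁ hΩ hU₁ hUΩ hδ₁i hδ₁2 hΩi hΩ2 hintδ₁ hintΩ hxδ₁ hxδ₁'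
    hδ₁'i hδ₁''i hF₁ hU₁Ω' hUΩδ₁'
  have h₂ := integral_linearisation_eq_half_integral (a := a) (ν := ν) hδ₂ hΩ hU₂ hUΩ hδ₂i hδ₂2 hΩi hΩ2 hintδ₂ hintΩ hxδ₂ hxδ₂'
    hδ₂'i hδ₂''i hF₂ hU₂Ω' hUΩδ₂'
  have e₁ : (fun X => δ₁ X + 1 / 2 * X * deriv δ₁ X + a * (U₁ X * deriv Ω X + UΩ X * deriv δ₁ X)
        - hilbertTransform δ₁ X * Ω X - hilbertTransform Ω X * δ₁ X - ν * deriv (deriv δ₁) X)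
      = fun X => -s * δ₁ X + t * δ₂ X := by
    funext X; linear_combination -(heig₁ X)
  have e₂ : (fun X => δ₂ X + 1 / 2 * X * deriv δ₂ X + a * (U₂ X * deriv Ω X + UΩ X * deriv δ₂ X)
        - hilbertTransform δ₂ X * Ω X - hilbertTransform Ω X * δ₂ X - ν * deriv (deriv δ₂) X)
      = fun X => -t * δ₁ X + -s * δ₂ X := by
    funext X; linear_combination -(heig₂ X)
  rw [e₁, integral_add (hδ₁i.const_mul _) (hδ₂i.const_mul _), integral_const_mul, integral_const_mul] at h₁
  rw [e₂, integral_add (hδ₁i.const_mul _) (hδ₂i.const_mul _), integral_const_mul, integral_const_mul] at h₂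
  -- the 2×2 system `(s+½)m₁ − t m₂ = 0`, `t m₁ + (s+½) m₂ = 0` has determinant `(s+½)² + t² > 0`
  set m₁ : ℝ := ∫ X, δ₁ X
  set m₂ : ℝ := ∫ X, δ₂ X
  have hdet : 0 < (s + 1 / 2) ^ 2 + t ^ 2 := by
    by_contra hle
    push Not at hle
    have hs : (s + 1 / 2) ^ 2 = 0 := le_antisymm (by nlinarith [sq_nonneg (s + 1 / 2), sq_nonneg t]) (sq_nonneg _)
    have ht : t ^ 2 = 0 := le_antisymm (by nlinarith [sq_nonneg (s + 1 / 2), sq_nonneg t]) (sq_nonneg _)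
    have hs' : s + 1 / 2 = 0 := (pow_eq_zero_iff two_ne_zero).1 hs
    exact hst ⟨by linarith, (pow_eq_zero_iff two_ne_zero).1 ht⟩
  have k₁ : ((s + 1 / 2) ^ 2 + t ^ 2) * m₁ = 0 := by linear_combination (-(s + 1 / 2)) * h₁ + (-t) * h₂
  have k₂ : ((s + 1 / 2) ^ 2 + t ^ 2) * m₂ = 0 := by linear_combination t * h₁ + (-(s + 1 / 2)) * h₂
  exact ⟨(mul_eq_zero.1 k₁).resolve_left hdet.ne', (mul_eq_zero.1 k₂).resolve_left hdet.ne'⟩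

/-! ### §4 The p.v. hypotheses discharged for `C¹ ∩ L¹ ∩ L²` data -/

/-- **The mass identity for `δ ∈ C² ∩ L¹ ∩ L²`, `Ω ∈ C¹ ∩ L¹ ∩ L²`** (the symmetric p.v. integrands are then integrable at EVERY
point, `integrableOn_symmIntegrand_of_contDiff`): `∫ DG⁺(Ω)[δ] = ½ ∫ δ` under the remaining `L¹` hypotheses on `ξδ, ξδ′, δ′, δ″` and
the velocity products. MODEL calculus; not NS. [folklore] -/
theorem integral_linearisation_eq_half_integral_of_contDiff (hδ : ContDiff ℝ 2 δ) (hΩ : ContDiff ℝ 1 Ω)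
    (hUδ : ∀ X, HasDerivAt Uδ (hilbertTransform δ X) X) (hUΩ : ∀ X, HasDerivAt UΩ (hilbertTransform Ω X) X)
    (hδi : Integrable δ) (hδ2 : MemLp δ 2) (hΩi : Integrable Ω) (hΩ2 : MemLp Ω 2)
    (hxδ : Integrable fun X => X * δ X) (hxδ' : Integrable fun X => X * deriv δ X)
    (hδ'i : Integrable (deriv δ)) (hδ''i : Integrable (deriv (deriv δ)))
    (hF : Integrable fun X => Uδ X * Ω X + UΩ X * δ X)
    (hUδΩ' : Integrable fun X => Uδ X * deriv Ω X) (hUΩδ' : Integrable fun X => UΩ X * deriv δ X) :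
    ∫ X, (δ X + 1 / 2 * X * deriv δ X + a * (Uδ X * deriv Ω X + UΩ X * deriv δ X)
        - hilbertTransform δ X * Ω X - hilbertTransform Ω X * δ X - ν * deriv (deriv δ) X) = 1 / 2 * ∫ X, δ X :=
  integral_linearisation_eq_half_integral hδ hΩ hUδ hUΩ hδi hδ2 hΩi hΩ2
    (ae_of_all _ (integrableOn_symmIntegrand_of_contDiff (hδ.of_le (by norm_num)) hδi))
    (ae_of_all _ (integrableOn_symmIntegrand_of_contDiff hΩ hΩi)) hxδ hxδ' hδ'i hδ''i hF hUδΩ' hUΩδ'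

end SheetRLinearisedMass
end Summit.NavierStokesRegularity.OSWSelfSimilar

end
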